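import Mathlib.Algebra.Polynomial.Roots
import Summits.KontsevichZagierPeriods.Zeta5Search.Certificates.PolyReflectPack
import HarnessLib

/-!
# ζ(5) search — packed identity tests on a GRID in the outer variable (cell `pub-zeta5`, certifier `cert-2`)

HONEST FRAMING: systematic search; recurrence certificates; no irrationality claim unless certified.

The three-variable Kronecker packing of `PolyReflectPack` (point `(β, β^{D₁}, β^{D₁D₂})`) produces integers of size
`≈ log₂β · D₁ · D₂ · (k-extent)`; for the lane's L-NK certificate this is ≈ 4·10⁸ bits, beyond the farm. This file
provides the soundness lemmas for the cheaper GRID variant: pack only `(w, x)` (point `(β, β^{D₁})`) and SPECIALISE the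
outer variable `k` to the integers `0, 1, …, K−1`; a `Poly3` with at most `K` blocks whose specialisations all vanish is
zero (`ev3_eq_zero_of_kgrid`), because for fixed `(w,x)` it is a polynomial in `k` of degree `< K` (`polyK`).
Pieces: the specialisation `kspec c k₀ : Poly2` (`ev2_kspec`, `evZ2_kspec`), its shape and 1-norm bounds (`rows_kspec`,
`norm2_kspec_le`), two-level injectivity `ev2_eq_zero_of_evZ2_eq_zero` (from the three-level theorem applied to a single
block), and the per-point criterion `ev3_kspec_eq_zero_of_packed`. The k-extent shadow and the grid form of
`PolyReflectCoord.coord_sum_eq_zero` are left to the L-NK kernel file.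
-/

namespace Summit.KontsevichZagierPeriods.Zeta5Search.PolyReflect

open Polynomial

/-! ### Specialising the outer variable -/

/-- `kspec c k₀`: the `Poly2` `Σ_j k₀^j · block_j` (the `Poly3` `c` with `k` specialised to the integer `k₀`). -/
def kspec : Poly3 → ℤ → Poly2
  | [], _ => []
  | b :: c, k₀ => add2 b (smul2 [k₀] (kspec c k₀))

/-- `ev2 (kspec c k₀) w x = ev3 c w x k₀`. -/
theorem ev2_kspec : ∀ (c : Poly3) (k₀ : ℤ) (w x : ℚ), ev2 (kspec c k₀) w x = ev3 c w x k₀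
  | [], _, _, _ => by simp [kspec]
  | b :: c, k₀, w, x => by
    rw [kspec, ev2_add2, ev2_smul2, ev2_kspec c k₀ w x, ev3_cons]
    simp [ev1]

/-- Integer version: `evZ2 (kspec c k₀) w x = evZ3 c w x k₀`. -/
theorem evZ2_kspec (c : Poly3) (k₀ w x : ℤ) : evZ2 (kspec c k₀) w x = evZ3 c w x k₀ := by
  have h1 := cast_evZ2 (kspec c k₀) w x
  have h2 := cast_evZ3 c w x k₀
  rw [ev2_kspec] at h1
  exact_mod_cast h1.trans h2.symm

/-- The number of rows of `kspec c k₀` is bounded by the block bound of `c`. -/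
theorem length_kspec {X : ℕ} : ∀ (c : Poly3) (k₀ : ℤ), (∀ b ∈ c, b.length ≤ X) → (kspec c k₀).length ≤ X
  | [], _, _ => by simp [kspec]
  | b :: c, k₀, h => by
    rw [kspec, length_add2, length_smul2]
    exact max_le (h b (by simp)) (length_kspec c k₀ fun b' hb' => h b' (by simp [hb']))

/-- The rows of `kspec c k₀` are bounded by the row bound of `c`. -/
theorem rows_kspec {W : ℕ} (hW : 1 ≤ W) :
    ∀ (c : Poly3) (k₀ : ℤ), (∀ b ∈ c, ∀ r ∈ b, r.length ≤ W) → ∀ r ∈ kspec c k₀, r.length ≤ W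
  | [], _, _ => by simp [kspec]
  | b :: c, k₀, h => by
    rw [kspec]
    have hr := rows_smul2 (Wc := 1) [k₀] (by simp) hW (kspec c k₀)
      (rows_kspec hW c k₀ fun b' hb' => h b' (by simp [hb']))
    rw [show 1 + W - 1 = W by omega] at hr
    exact rows_add2 b _ (h b (by simp)) hr

/-- 1-norm of the specialisation: `norm2 (kspec c k₀) ≤ norm3 c · B^{|c|}` for `|k₀| ≤ B`, `1 ≤ B`. -/
theorem norm2_kspec_le (B : ℕ) (hB : 1 ≤ B) (k₀ : ℤ) (hk : k₀.natAbs ≤ B) :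
    ∀ c : Poly3, norm2 (kspec c k₀) ≤ norm3 c * B ^ c.length
  | [] => by simp [kspec]
  | b :: c => by
    rw [kspec]
    have ih := norm2_kspec_le B hB k₀ hk c
    have h1 := norm2_add2 b (smul2 [k₀] (kspec c k₀))
    have h2 := norm2_smul2 [k₀] (kspec c k₀)
    have hn1 : norm1 [k₀] = k₀.natAbs := by simp
    rw [hn1] at h2
    have hpow : 1 ≤ B ^ c.length := Nat.one_le_pow _ _ hB
    calc norm2 (add2 b (smul2 [k₀] (kspec c k₀)))
        ≤ norm2 b + k₀.natAbs * norm2 (kspec c k₀) := h1.trans (Nat.add_le_add_left h2 _)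
      _ ≤ norm2 b * B ^ c.length * B + B * (norm3 c * B ^ c.length) := by
          have e1 : norm2 b ≤ norm2 b * B ^ c.length * B := by
            calc norm2 b = norm2 b * 1 * 1 := by ring
              _ ≤ norm2 b * B ^ c.length * B := by gcongr
          have e2 : k₀.natAbs * norm2 (kspec c k₀) ≤ B * (norm3 c * B ^ c.length) := Nat.mul_le_mul hk ih
          omega
      _ = norm3 (b :: c) * B ^ (b :: c).length := by
          simp only [norm3_cons, List.length_cons, pow_succ]; ring

/-! ### Two-level injectivity and the per-point criterion -/

/-- **Two-level injectivity**: a `Poly2` with rows of length `≤ D₁` and 1-norm `< β` whose packed value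
`evZ2 q β β^{D₁}` vanishes evaluates to `0` everywhere (the three-level theorem applied to the single block `[q]`). -/
theorem ev2_eq_zero_of_evZ2_eq_zero (q : Poly2) (β D₁ : ℕ) (hD₁ : 1 ≤ D₁) (hn : norm2 q < β)
    (hrows : ∀ r ∈ q, r.length ≤ D₁) (h0 : evZ2 q β ((β : ℤ) ^ D₁) = 0) (w x : ℚ) : ev2 q w x = 0 := by
  have h3 := ev3_eq_zero_of_evZ3_eq_zero [q] β D₁ (max 1 q.length) hD₁ (le_max_left _ _) (by simpa using hn)
    (by
      intro b hb
      simp only [List.mem_cons, List.not_mem_nil, or_false] at hb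
      subst hb
      exact ⟨le_max_right _ _, hrows⟩)
    (by simp [evZ3, h0]) w x 0
  simpa using h3

/-- **Per-point criterion**: if `c` has rows `≤ D₁`, blocks of `≤ X` rows, at most `Kb` blocks and 1-norm `≤ H` with
`H · B^{Kb} < β`, `|k₀| ≤ B`, and the two-variable packed value at `k = k₀` vanishes, then `ev3 c w x k₀ = 0` for all
rational `w, x`. -/
theorem ev3_kspec_eq_zero_of_packed (c : Poly3) (β D₁ H Kb B : ℕ) (hD₁ : 1 ≤ D₁) (hB : 1 ≤ B)
    (hsh : ∀ b ∈ c, ∀ r ∈ b, r.length ≤ D₁) (hn : norm3 c ≤ H) (hlen : c.length ≤ Kb) (hβ : H * B ^ Kb < β)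
    (k₀ : ℤ) (hk : k₀.natAbs ≤ B) (h0 : evZ3 c β ((β : ℤ) ^ D₁) k₀ = 0) (w x : ℚ) : ev3 c w x k₀ = 0 := by
  rw [← ev2_kspec]
  refine ev2_eq_zero_of_evZ2_eq_zero (kspec c k₀) β D₁ hD₁ ?_ (rows_kspec hD₁ c k₀ hsh) ?_ w x
  · have h1 := norm2_kspec_le B hB k₀ hk c
    have h2 : norm3 c * B ^ c.length ≤ H * B ^ Kb :=
      Nat.mul_le_mul hn (Nat.pow_le_pow_right hB hlen)
    omega
  · rw [evZ2_kspec]; exact h0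

/-! ### The polynomial in `k` and the grid criterion -/

/-- For fixed `(w, x)`, the polynomial `Σ_j ev2(block_j)(w,x) · X^j ∈ ℚ[X]` of a `Poly3`. -/
noncomputable def polyK (w x : ℚ) : Poly3 → ℚ[X]
  | [] => 0
  | b :: c => C (ev2 b w x) + X * polyK w x c

/-- `(polyK w x c).eval k = ev3 c w x k`. -/
theorem eval_polyK (w x : ℚ) : ∀ (c : Poly3) (k : ℚ), (polyK w x c).eval k = ev3 c w x k
  | [], k => by simp [polyK]
  | b :: c, k => by simp [polyK, eval_polyK w x c k]

/-- Degree bound: `natDegree (polyK w x c) + 1 ≤ max 1 |c|`. -/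
theorem natDegree_polyK_le (w x : ℚ) : ∀ c : Poly3, (polyK w x c).natDegree + 1 ≤ max 1 c.length
  | [] => by simp [polyK]
  | b :: c => by
    have ih := natDegree_polyK_le w x c
    rw [polyK, List.length_cons]
    by_cases hp : polyK w x c = 0
    · simp [hp]
    · have hc : 1 ≤ c.length := by
        rcases c with _ | ⟨b', c'⟩
        · simp [polyK] at hp
        · simp
      have h1 := natDegree_add_le (C (ev2 b w x)) (X * polyK w x c)
      rw [natDegree_C, natDegree_X_mul hp] at h1
      omega

/-- **Grid criterion**: a `Poly3` with at most `K` blocks that vanishes at `k = 0, 1, …, K−1` for all rational `(w,x)`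
vanishes everywhere. -/
theorem ev3_eq_zero_of_kgrid (c : Poly3) (K : ℕ) (hlen : c.length ≤ K)
    (h : ∀ k₀ : ℕ, k₀ < K → ∀ w x : ℚ, ev3 c w x k₀ = 0) (w x k : ℚ) : ev3 c w x k = 0 := by
  have hP : polyK w x c = 0 := by
    by_cases hc : c = []
    · subst hc; simp [polyK]
    · have hc1 : 1 ≤ c.length := by
        rcases c with _ | ⟨b', c'⟩
        · exact absurd rfl hc
        · simp
      refine eq_zero_of_natDegree_lt_card_of_eval_eq_zero (polyK w x c) (ι := Fin K) (f := fun i => ((i : ℕ) : ℚ))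
        (fun i j (hij : ((i : ℕ) : ℚ) = ((j : ℕ) : ℚ)) => Fin.ext (by exact_mod_cast hij)) (fun i => ?_) ?_
      · rw [eval_polyK]; exact h i i.isLt w x
      · have := natDegree_polyK_le w x c
        simp only [Fintype.card_fin]
        omega
  rw [← eval_polyK, hP, eval_zero]

/-- The grid criterion for a whole combination: every entry of `E` vanishes identically once its `k`-specialisations
at `0..K−1` do (entries with at most `K` blocks). -/
theorem lcEval_eq_zero_of_kgrid (T : ℕ → ℚ) (w x k : ℚ) (E : LC) (K : ℕ) (hlen : ∀ c ∈ E, c.length ≤ K)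
    (h : ∀ k₀ : ℕ, k₀ < K → ∀ c ∈ E, ∀ w x : ℚ, ev3 c w x k₀ = 0) : lcEval T w x k 0 E = 0 :=
  lcEval_eq_zero_of_forall T w x k E 0 fun c hc =>
    ev3_eq_zero_of_kgrid c K (hlen c hc) (fun k₀ hk₀ w' x' => h k₀ hk₀ c hc w' x') w x k

end Summit.KontsevichZagierPeriods.Zeta5Search.PolyReflect
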